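import Literature.MathematicalPhysics.KineticTheory.HardSphereEulerTwoEosStability
import Literature.MathematicalPhysics.KineticTheory.HardSphereEulerStabilityEstimate

/-!
# `DiluteSelfConsistency` (stmt-AtomisticToContinuum-3091), line `birth` rev c3 — stub 4d `stub_stabilityEstimate`

Registered stub of the crux skeleton `Cruxes/DiluteSelfConsistency/Lines/birth.lean` (rev c3, lead
prover-line-stmt-AtomisticToContinuum-3091-c3-0): layer 4 of Kato's continuous-dependence theorem for the hard-sphere
Euler family — the fixed-horizon a-priori stability estimate `hstab` of `hsEuler_continuousDependence_of_localTheory` —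
from the three analytic inputs 4a (smallness interpolation on `𝕋³`), 4b (σ-uniform `H³` energy inequality) and 4c
(data bound for `D₃`). It is the composition of the two Literature theorems landed for it:
`HsEulerStability.hsEuler_twoEos_level0_stability` (`HardSphereEulerTwoEosStability.lean`: σ-uniform level-0
relative-energy stability between a σ-solution and an ideal-gas reference) and
`HsEulerStability.stabilityEstimate_of_level0` (`HardSphereEulerStabilityEstimate.lean`: the bootstrap).
-/

noncomputable section

namespace Summit.AtomisticToContinuum.HydrodynamicLimit.Theorems

open MeasureTheory Set
open Literature.MathematicalPhysics.KineticTheory Literature.Analysis.FluidPDE Literature.Analysis.FunctionSpaces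

/-- **Stub 4d (layer 4 of Kato's Thm III for the hard-sphere family: the fixed-horizon a-priori stability estimate,
from 4a–4c).** Given smallness interpolation (4a), the σ-uniform `H³` inequality (4b) and the data bound (4c): under the
equation-of-state hypothesis, for every ideal-gas reference solution on `[0, T₁)`, every `0 < T' < T₁` and `ε > 0`
there are `k`, `δ > 0`, `M > 0` such that for `0 < σ < δ` and smooth positive data `δ`-close in `Cᵏ` to the reference
data, EVERY classical σ-solution with these data on `[0, T)`, `T ≤ T'`, obeys `M⁻¹ ≤ ρ, θ ≤ M`, `‖u‖ ≤ M`,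
`|∂ᵢ(ρ, u, θ)| ≤ M` and is `ε`-close to the reference pointwise on `[0, T) × 𝕋³`. The level-0 input of the bootstrap
`HsEulerStability.stabilityEstimate_of_level0` is the tree theorem `HsEulerStability.hsEuler_twoEos_level0_stability`.
[cite: Kato1975, Thm III] [cite: Majda1984, Ch. 2 §2.1 Thm 2.2] -/
theorem stub_stabilityEstimate :
    (∀ E ε : ℝ, 0 < ε → ∃ δ : ℝ, 0 < δ ∧ ∀ f : T3 → ℝ, Torus.IsSmooth f →
      (∫ x, f x ^ 2) ≤ δ →
      (∀ i : Fin 3, (∫ x, Torus.partialDeriv i f x ^ 2) ≤ E) →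
      (∀ i j : Fin 3, (∫ x, Torus.partialDeriv i (Torus.partialDeriv j f) x ^ 2) ≤ E) →
      (∀ i j l : Fin 3, (∫ x, Torus.partialDeriv i (Torus.partialDeriv j (Torus.partialDeriv l f)) x ^ 2) ≤ E) →
      ∀ x, |f x| ≤ ε ∧ ∀ i : Fin 3, |Torus.partialDeriv i f x| ≤ ε) →
    (∀ η₀ : ℝ, 0 < η₀ → ∀ F : ℝ → ℝ, AnalyticOnNhd ℝ F (Ioo (-η₀) η₀) →
      EqOn hsExcessFreeEnergy F (Ico 0 η₀) →
      ∀ M Λ : ℝ, 1 ≤ M → 1 ≤ Λ → ∃ ηP C κ : ℝ, 0 < ηP ∧ 1 ≤ C ∧ 0 ≤ κ ∧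
        ∀ σ : ℝ, 0 < σ → ∀ T : ℝ, 0 < T →
        ∀ (ρ θ : ℝ → T3 → ℝ) (u : ℝ → T3 → V3), IsHardSphereEulerSolution σ T ρ u θ →
        (∀ t ∈ Ico 0 T, ∀ x, M⁻¹ ≤ ρ t x ∧ ρ t x ≤ M ∧ M⁻¹ ≤ θ t x ∧ θ t x ≤ M ∧ ‖u t x‖ ≤ Λ ∧
            ρ t x * σ ^ 3 ≤ ηP ∧
            ∀ i : Fin 3, |Torus.partialDeriv i (ρ t) x| ≤ Λ ∧ ‖Torus.partialDeriv i (u t) x‖ ≤ Λ ∧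
              |Torus.partialDeriv i (θ t) x| ≤ Λ) →
        ∀ t ∈ Ico 0 T,
          CompressibleEuler.derivLevelEnergy ρ u θ 3 t ≤
            C * Real.exp (κ * t) * CompressibleEuler.derivLevelEnergy ρ u θ 3 0) →
    (∀ (ρ θ : ℝ → T3 → ℝ) (u : ℝ → T3 → V3) (t B : ℝ), 0 ≤ B →
      Torus.IsSmooth (ρ t) → Torus.IsSmooth (θ t) → Torus.IsSmooth (u t) →
      (∀ w : List (Fin 3), 1 ≤ w.length → w.length ≤ 3 → ∀ x,
          |Torus.iterPartialDeriv w (ρ t) x| ≤ B ∧ ‖Torus.iterPartialDeriv w (u t) x‖ ≤ B ∧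
            |Torus.iterPartialDeriv w (θ t) x| ≤ B) →
      CompressibleEuler.derivLevelEnergy ρ u θ 3 t ≤ 200 * B ^ 2) →
    ∀ η₀ : ℝ, 0 < η₀ → ∀ F : ℝ → ℝ, AnalyticOnNhd ℝ F (Ioo (-η₀) η₀) →
      EqOn hsExcessFreeEnergy F (Ico 0 η₀) →
      ∀ (T₁ : ℝ) (ρ₁ θ₁ : ℝ → T3 → ℝ) (u₁ : ℝ → T3 → V3), IsHardSphereEulerSolution 0 T₁ ρ₁ u₁ θ₁ →
        ∀ T' : ℝ, 0 < T' → T' < T₁ → ∀ ε : ℝ, 0 < ε →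
        ∃ k : ℕ, ∃ δ M : ℝ, 0 < δ ∧ 0 < M ∧ ∀ σ : ℝ, 0 < σ → σ < δ →
          ∀ (ρ₀ θ₀ : T3 → ℝ) (u₀ : T3 → V3),
            Torus.IsSmooth ρ₀ → Torus.IsSmooth θ₀ → Torus.IsSmooth u₀ →
            (∀ x, 0 < ρ₀ x) → (∀ x, 0 < θ₀ x) →
            (∀ n : ℕ, n ≤ k → ∀ y : EuclideanSpace ℝ (Fin 3),
              ‖iteratedFDeriv ℝ n (Torus.lift fun x => ρ₀ x - ρ₁ 0 x) y‖ ≤ δ) →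
            (∀ n : ℕ, n ≤ k → ∀ y : EuclideanSpace ℝ (Fin 3),
              ‖iteratedFDeriv ℝ n (Torus.lift fun x => θ₀ x - θ₁ 0 x) y‖ ≤ δ) →
            (∀ n : ℕ, n ≤ k → ∀ y : EuclideanSpace ℝ (Fin 3),
              ‖iteratedFDeriv ℝ n (Torus.lift fun x => u₀ x - u₁ 0 x) y‖ ≤ δ) →
            ∀ T : ℝ, T ≤ T' → ∀ (ρ θ : ℝ → T3 → ℝ) (u : ℝ → T3 → V3),
              IsHardSphereEulerSolution σ T ρ u θ → ρ 0 = ρ₀ → u 0 = u₀ → θ 0 = θ₀ →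
              ∀ t ∈ Ico 0 T, ∀ x,
                (M⁻¹ ≤ ρ t x ∧ ρ t x ≤ M ∧ M⁻¹ ≤ θ t x ∧ θ t x ≤ M ∧ ‖u t x‖ ≤ M ∧
                  ∀ i : Fin 3, ‖Torus.partialDeriv i (u t) x‖ ≤ M ∧
                    |Torus.partialDeriv i (ρ t) x| ≤ M ∧ |Torus.partialDeriv i (θ t) x| ≤ M) ∧
                (|ρ t x - ρ₁ t x| < ε ∧ ‖u t x - u₁ t x‖ < ε ∧ |θ t x - θ₁ t x| < ε) :=
  fun hS hH hD => HsEulerStability.stabilityEstimate_of_level0 HsEulerStability.hsEuler_twoEos_level0_stability hS hH hD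

end Summit.AtomisticToContinuum.HydrodynamicLimit.Theorems

end
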